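import Summits.PneNP.PneNP.Theorems.RamseyUncertifiableResolutionUncertaintyCareful
import Summits.PneNP.PneNP.Theorems.RamseyUncertifiableResolutionUncertaintyTreeLikeRung

/-!
# CAREFUL refutations, II: the careful rung of `RamseyUncertifiable.ResolutionUncertainty` — item stmt-PneNP-9816
# (support)

Consequences of `careful_cliqueCNF_card_cliqueFinset_le` (file I, …Careful.lean):

* `isCareful_mono` — carefulness is monotone in the threshold;
* `careful_length_ge_card_cliqueFinset` — the case `t = p`: a `p`-careful resolution refutation of the unary
  `Clique(G, k)` has at least `#(p-cliques of G)` lines (the pin-monotone theorem is the case "careful for all `p`");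
* `careful_resolutionUncertainty` — THE ITEM FOR CAREFUL REFUTATIONS: there are `c, ε > 0` and `n₀` such that for every
  graph `G` on `n ≥ n₀` vertices, every `⌈c log₂ n⌉`-careful resolution refutation `π₁` of `Clique(G, ⌈log₂ n²⌉)` has
  length `≥ n^{ε log₂ n}` as soon as `Clique(Gᶜ, ⌈log₂ n²⌉)` has any refutation (Prömel–Rödl core + dense clique
  counting, as in …TreeLikeRung.lean, with `T = ⌊c log₂ |S|⌋ ≤ ⌈c log₂ n⌉`).
  Contrapositive: a refutation of length `n^{o(log n)}` of the clique formula of a 2-Ramsey graph drops pins from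
  clauses with fewer than `c log₂ n` negative literals — it forgets decisions at logarithmic depth at the latest.
-/

set_option linter.dupNamespace false

namespace Summit.PneNP.PneNP.Theorems.RamseyUncertifiableResolutionUncertainty

open Literature.Computability.Complexity Literature.Computability.MetaComplexity
open Summit.PneNP.PneNP.Theorems.RegularResolutionRung.Negative (cliqueCNF)

/-- Carefulness is monotone: a `p`-careful derivation is `p'`-careful for every `p' ≤ p`. -/
theorem isCareful_mono {π : List (ResLine ℕ)} {p p' : ℕ} (hpp : p' ≤ p) (h : IsCareful p π) : IsCareful p' π := by
  intro t ht
  have hm := h t ht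
  rcases hrule : (π[t]'ht).rule with _ | ⟨i, j, v⟩ | ⟨i⟩
  · simp only
  · rw [hrule] at hm
    obtain ⟨hmi, hmj⟩ := hm
    exact ⟨fun hi hni hex => hpp.trans (hmi hi hni hex), fun hj hnj hex => hpp.trans (hmj hj hnj hex)⟩
  · rw [hrule] at hm
    exact fun hi hni hex => hpp.trans (hm hi hni hex)

/-- **`p`-careful refutations of `Clique(G, k)` have at least `#(p-cliques of G)` lines** (the case `t = p` of
`careful_cliqueCNF_card_cliqueFinset_le`). -/
theorem careful_length_ge_card_cliqueFinset {n k : ℕ} (G : SimpleGraph (Fin n)) [DecidableRel G.Adj]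
    (π : List (ResLine ℕ)) (p : ℕ) (hπ : IsResRefutation (cliqueCNF n k fun u v => decide (G.Adj u v)) π)
    (hcare : IsCareful p π) : (G.cliqueFinset p).card ≤ π.length := by
  have h := careful_cliqueCNF_card_cliqueFinset_le G π p p hπ hcare le_rfl
  simpa using h

/-- **The item for CAREFUL refutations (proved).** There are `c > 0`, `ε > 0` and `n₀` such that for every graph
`G` on `n ≥ n₀` vertices, every `⌈c log₂ n⌉`-careful resolution refutation `π₁` of the unary `Clique(G, ⌈log₂ n²⌉)`
has length `≥ n^{ε log₂ n}` as soon as `Clique(Gᶜ, ⌈log₂ n²⌉)` has any resolution refutation. -/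
theorem careful_resolutionUncertainty :
    ∃ c : ℝ, 0 < c ∧ ∃ ε : ℝ, 0 < ε ∧ ∃ n₀ : ℕ, ∀ n ≥ n₀, ∀ (G : SimpleGraph (Fin n)) [DecidableRel G.Adj],
      ∀ π₁ π₂ : List (ResLine ℕ),
        IsResRefutation (cliqueCNF n (Nat.clog 2 (n ^ 2)) fun u v => decide (G.Adj u v)) π₁ →
        IsCareful ⌈c * Real.logb 2 n⌉₊ π₁ →
        IsResRefutation (cliqueCNF n (Nat.clog 2 (n ^ 2)) fun u v => decide (Gᶜ.Adj u v)) π₂ →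
        (n : ℝ) ^ (ε * Real.logb 2 n) ≤ π₁.length := by
  -- the core
  obtain ⟨β, δ₀, hβ0, hβ1, hδ₀, n₁, hcore⟩ := stub_promelRodl stub_drcStep
  set δ : ℝ := min δ₀ 1 with hδdef
  have hδ0 : 0 < δ := lt_min hδ₀ one_pos
  have hδ1 : δ ≤ 1 := min_le_right _ _
  have hδle : δ ≤ δ₀ := min_le_left _ _
  -- constants
  set a : ℝ := Real.logb 2 (4 / δ) with ha
  have ha2 : 2 ≤ a := two_le_logb_four_div hδ0 hδ1
  set c : ℝ := β / (2 * a) with hc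
  have hc0 : 0 < c := by positivity
  set Λ : ℝ := max (6 / β) (max (16 * c / (3 * (1 - β) ^ 2 * (Real.log 2) ^ 2)) (2 / c)) with hΛ
  obtain ⟨S₀, hS₀2, hS₀⟩ := exists_threshold Λ
  set ε' : ℝ := (1 - β) * c / 4 with hε'
  have hε'0 : 0 < ε' := by
    have : 0 < 1 - β := by linarith
    positivity
  refine ⟨c, hc0, 9 / 16 * ε', by positivity, max n₁ (S₀ ^ 2), ?_⟩
  intro n hn G inst π₁ π₂ h₁ hcare h₂
  have hn₁ : n₁ ≤ n := le_trans (le_max_left _ _) hn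
  have hnS : S₀ ^ 2 ≤ n := le_trans (le_max_right _ _) hn
  have hn4 : 4 ≤ n := le_trans (by nlinarith) hnS
  have hn1 : (1 : ℝ) ≤ n := by exact_mod_cast le_trans (by norm_num) hn4
  have hnpos : (0 : ℝ) < n := by linarith
  set k : ℕ := Nat.clog 2 (n ^ 2) with hk
  -- soundness on both sides, then the core
  have hfree : G.CliqueFree k := cliqueFree_of_refutation G h₁
  have hfreeC : Gᶜ.CliqueFree k := cliqueFree_of_refutation Gᶜ h₂
  obtain ⟨S, hS, hdense⟩ := hcore n hn₁ G hfree hfreeC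
  set s : ℕ := S.card with hsdef
  -- `s ≥ S₀`
  have hsS₀ : S₀ ≤ s := by
    have h1 : ((S₀ : ℝ)) ≤ (n : ℝ) ^ ((1 : ℝ) / 2) := by
      rw [← Real.sqrt_eq_rpow, Real.le_sqrt (by positivity) (by positivity)]
      exact_mod_cast hnS
    have h2 : (n : ℝ) ^ ((1 : ℝ) / 2) ≤ (n : ℝ) ^ ((3 : ℝ) / 4) :=
      Real.rpow_le_rpow_of_exponent_le hn1 (by norm_num)
    exact_mod_cast (h1.trans h2).trans hS
  have hs2 : 2 ≤ s := le_trans hS₀2 hsS₀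
  have hs0 : (0 : ℝ) < s := by exact_mod_cast lt_of_lt_of_le (by norm_num) hs2
  have hΛs : Λ ≤ Real.logb 2 s := hS₀ s hsS₀
  have hL1 : 6 / β ≤ Real.logb 2 s := le_trans (le_max_left _ _) hΛs
  have hL2 : 16 * c / (3 * (1 - β) ^ 2 * (Real.log 2) ^ 2) ≤ Real.logb 2 s :=
    le_trans (le_trans (le_max_left _ _) (le_max_right _ _)) hΛs
  have hL3 : 2 / c ≤ Real.logb 2 s := le_trans (le_trans (le_max_right _ _) (le_max_right _ _)) hΛs
  -- scale, levels
  set M : ℕ := ⌈(s : ℝ) ^ (1 - β)⌉₊ with hMdef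
  have hM1 : 1 ≤ M := by
    rw [hMdef, Nat.one_le_ceil_iff]
    exact Real.rpow_pos_of_pos hs0 _
  set T : ℕ := ⌊c * Real.logb 2 s⌋₊ with hTdef
  have hcL0 : 0 ≤ c * Real.logb 2 s :=
    mul_nonneg hc0.le (Real.logb_nonneg one_lt_two (by exact_mod_cast le_trans (by norm_num) hs2))
  have hTle : (T : ℝ) ≤ c * Real.logb 2 s := Nat.floor_le hcL0
  have hTge : c * Real.logb 2 s - 1 ≤ T := by
    have := Nat.lt_floor_add_one (c * Real.logb 2 s)
    rw [← hTdef] at this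
    linarith
  -- density at scale `M` (one-sided) inside `S`
  have hdenseM : ∀ A ⊆ S, ∀ B ⊆ S, Disjoint A B → M ≤ A.card → M ≤ B.card → δ ≤ (G.edgeDensity A B : ℝ) := by
    intro A hA B hB hAB hMA hMB
    have hA' : (S.card : ℝ) ^ (1 - β) ≤ A.card := le_trans (Nat.le_ceil _) (by exact_mod_cast hMA)
    have hB' : (S.card : ℝ) ^ (1 - β) ≤ B.card := le_trans (Nat.le_ceil _) (by exact_mod_cast hMB)
    exact hδle.trans (hdense A hA B hB hAB hA' hB').1
  -- room and the count
  have hroom : (4 * M : ℝ) ≤ (δ / 4) ^ T * S.card := room_of_large hβ0 hβ1 hδ0 hδ1 hs2 hTle hL1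
  have hcount := pow_le_factorial_mul_card_cliqueFinset G S M T δ hδ0 (by linarith) hM1 hdenseM hroom
  -- careful refutations enumerate `T`-cliques once the carefulness threshold is `≥ T`
  have hsn : s ≤ n := by
    rw [hsdef]; exact (Finset.card_le_univ S).trans_eq (Fintype.card_fin n)
  have hTp : T ≤ ⌈c * Real.logb 2 n⌉₊ := by
    have h1 : Real.logb 2 s ≤ Real.logb 2 n :=
      Real.logb_le_logb_of_le one_lt_two hs0 (by exact_mod_cast hsn)
    have h2 : (T : ℝ) ≤ c * Real.logb 2 n := hTle.trans (mul_le_mul_of_nonneg_left h1 hc0.le)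
    have h3 : (T : ℝ) ≤ (⌈c * Real.logb 2 n⌉₊ : ℝ) := h2.trans (Nat.le_ceil _)
    exact_mod_cast h3
  have htl := careful_length_ge_card_cliqueFinset G π₁ T h₁ (isCareful_mono hTp hcare)
  -- numerics
  have hlev : (T : ℝ) ≤ 3 * Real.sqrt M := by
    rw [hMdef]; exact levels_of_large hβ1 hs2 hTle hL2
  have hexp := exponent_of_count hβ1 hc0 hs2 rfl hcount hlev hTge hL3
  -- `n^{(9/16) ε' log₂ n} ≤ 2^{ε' (log₂ s)²}`
  have hx0 : 0 ≤ Real.logb 2 n := Real.logb_nonneg one_lt_two hn1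
  have h34 : 3 / 4 * Real.logb 2 n ≤ Real.logb 2 s := by
    have := Real.logb_le_logb_of_le (b := 2) one_lt_two (by positivity) hS
    rwa [Real.logb_rpow_eq_mul_logb_of_pos hnpos] at this
  have hmain : (n : ℝ) ^ (9 / 16 * ε' * Real.logb 2 n) ≤ (2 : ℝ) ^ (ε' * Real.logb 2 s ^ 2) := by
    rw [rpow_eq_two_rpow hnpos]
    refine Real.rpow_le_rpow_of_exponent_le one_le_two ?_
    have : Real.logb 2 n * (9 / 16 * ε' * Real.logb 2 n) = ε' * (3 / 4 * Real.logb 2 n) ^ 2 := by ring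
    rw [this]
    refine mul_le_mul_of_nonneg_left ?_ hε'0.le
    exact pow_le_pow_left₀ (by positivity) h34 2
  calc (n : ℝ) ^ (9 / 16 * ε' * Real.logb 2 n) ≤ (2 : ℝ) ^ (ε' * Real.logb 2 s ^ 2) := hmain
    _ ≤ ((G.cliqueFinset T).card : ℝ) := by rw [hε']; exact hexp
    _ ≤ π₁.length := by exact_mod_cast htl


end Summit.PneNP.PneNP.Theorems.RamseyUncertifiableResolutionUncertainty
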